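import Mathlib
import Literature.Computability.AlgebraicComplexity.StandardFamilies

/-!
# Homogeneous selection for line `Sketch` of crux `CertWindowQP` (stmt-ValiantsHypothesis-5640)

Stub `stub_homogSelect` of the registered skeleton. The content is generic: if
`g : ι → MvPolynomial τ R` is a family of polynomials all homogeneous of the same degree `m ≠ 0`
and `q ∈ R[Y_ι]` satisfies `q(g) = 0`, then every homogeneous component `q_i` of `q` satisfies
`q_i(g) = 0` (the `q_i(g)` are homogeneous of the pairwise distinct degrees `m·i`, so the graded
decomposition of `0 = q(g) = ∑ q_i(g)` kills each of them); and if moreover `q(c) ≠ 0` at some point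
`c`, one of the components keeps `q_i(c) ≠ 0`. The stub is the specialisation to the coefficient
family of the generic pencil determinant and the coefficient vector of `per_n` (Mathlib only).
-/

open MvPolynomial

namespace Summit.ValiantsHypothesis.ValiantsHypothesis.Theorems

open Literature.Computability.AlgebraicComplexity

set_option linter.dupNamespace false

/-- If `g : ι → MvPolynomial τ R` are all homogeneous of the same degree `m ≠ 0` and `aeval g q = 0`,
then `aeval g` already kills every homogeneous component of `q`: the images of the components are
homogeneous of the pairwise distinct degrees `m * i`, and a sum of homogeneous polynomials of
distinct degrees vanishes only if each summand does. -/
theorem certWindowQP_aeval_homogeneousComponent_eq_zero {ι τ R : Type*} [CommSemiring R]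
    {m : ℕ} (hm : m ≠ 0) (g : ι → MvPolynomial τ R) (hg : ∀ j, (g j).IsHomogeneous m)
    (q : MvPolynomial ι R) (hq : aeval g q = 0) (i : ℕ) :
    aeval g (homogeneousComponent i q) = 0 := by
  classical
  -- the graded pieces `r j := aeval g (homogeneousComponent j q)` sum to `aeval g q = 0`
  have hsum : ∑ j ∈ Finset.range (q.totalDegree + 1), aeval g (homogeneousComponent j q) = 0 := by
    rw [← map_sum, sum_homogeneousComponent, hq]
  -- `r j` is homogeneous of degree `m * j`, so its degree-`m * i` component is `r j` or `0`
  have hcomp : ∀ j, homogeneousComponent (m * i) (aeval g (homogeneousComponent j q)) =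
      if i = j then aeval g (homogeneousComponent j q) else 0 := by
    intro j
    rw [homogeneousComponent_of_mem ((homogeneousComponent_isHomogeneous j q).aeval g hg)]
    by_cases hij : i = j
    · rw [if_pos hij, if_pos (by rw [hij])]
    · rw [if_neg hij, if_neg fun h => hij (Nat.eq_of_mul_eq_mul_left (Nat.pos_of_ne_zero hm) h)]
  have key := congrArg (homogeneousComponent (m * i)) hsum
  rw [map_sum, map_zero] at key
  simp_rw [hcomp, Finset.sum_ite_eq] at key
  by_cases hi : i ∈ Finset.range (q.totalDegree + 1)
  · rwa [if_pos hi] at key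
  · rw [homogeneousComponent_eq_zero i q (by simpa [Finset.mem_range, Nat.lt_succ_iff] using hi),
      map_zero]

/-- **Homogeneous selection (generic form).** If `g : ι → MvPolynomial τ R` are all homogeneous of
the same degree `m ≠ 0`, `q(g) = 0` and `q(c) ≠ 0`, then some homogeneous component `F` of `q` has
the same two properties: `F(g) = 0` (by `certWindowQP_aeval_homogeneousComponent_eq_zero`) and
`F(c) ≠ 0` (since `q(c) = ∑ᵢ qᵢ(c) ≠ 0`). -/
theorem certWindowQP_homogSelect {ι τ R : Type*} [CommSemiring R]
    {m : ℕ} (hm : m ≠ 0) (g : ι → MvPolynomial τ R) (hg : ∀ j, (g j).IsHomogeneous m)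
    (c : ι → R) (q : MvPolynomial ι R) (hq0 : eval c q ≠ 0) (hqP : aeval g q = 0) :
    ∃ (i : ℕ) (F : MvPolynomial ι R), F.IsHomogeneous i ∧ eval c F ≠ 0 ∧ aeval g F = 0 := by
  have h : ∑ i ∈ Finset.range (q.totalDegree + 1), eval c (homogeneousComponent i q) ≠ 0 := by
    rwa [← map_sum, sum_homogeneousComponent]
  obtain ⟨i, -, hi⟩ := Finset.exists_ne_zero_of_sum_ne_zero h
  exact ⟨i, homogeneousComponent i q, homogeneousComponent_isHomogeneous i q, hi,
    certWindowQP_aeval_homogeneousComponent_eq_zero hm g hg q hqP i⟩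

/-- **Registered stub `stub_homogSelect`** of line `Sketch` (crux `CertWindowQP`,
stmt-ValiantsHypothesis-5640), verbatim signature of the registered skeleton: if the `x`-coefficients
`P_μ` of the generic pencil determinant are all homogeneous of degree `m ≥ 1` in the unknowns, a
relation `q(P) = 0` with `q(coeff per_n) ≠ 0` may be replaced by one of the homogeneous components of
`q`. Immediate from the generic `certWindowQP_homogSelect`. -/
theorem stub_homogSelect (n m : ℕ) [NeZero m] (q : MvPolynomial ((Fin n × Fin n) →₀ ℕ) ℂ)
    (hhom : ∀ μ : (Fin n × Fin n) →₀ ℕ, (MvPolynomial.coeff μ (Matrix.of fun i j : Fin m => MvPolynomial.C (MvPolynomial.X (none, (i, j))) + ∑ e : Fin n × Fin n, MvPolynomial.X e * MvPolynomial.C (MvPolynomial.X (some e, (i, j))) : Matrix (Fin m) (Fin m) (MvPolynomial (Fin n × Fin n) (MvPolynomial (Option (Fin n × Fin n) × (Fin m × Fin m)) ℂ))).det).IsHomogeneous m)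
    (hq0 : MvPolynomial.eval (fun μ : (Fin n × Fin n) →₀ ℕ => MvPolynomial.coeff μ (perPoly (Fin n) ℂ)) q ≠ 0)
    (hqP : MvPolynomial.aeval (fun μ : (Fin n × Fin n) →₀ ℕ => MvPolynomial.coeff μ (Matrix.of fun i j : Fin m => MvPolynomial.C (MvPolynomial.X (none, (i, j))) + ∑ e : Fin n × Fin n, MvPolynomial.X e * MvPolynomial.C (MvPolynomial.X (some e, (i, j))) : Matrix (Fin m) (Fin m) (MvPolynomial (Fin n × Fin n) (MvPolynomial (Option (Fin n × Fin n) × (Fin m × Fin m)) ℂ))).det) q = 0) :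
    ∃ (i : ℕ) (F : MvPolynomial ((Fin n × Fin n) →₀ ℕ) ℂ), F.IsHomogeneous i ∧
      MvPolynomial.eval (fun μ : (Fin n × Fin n) →₀ ℕ => MvPolynomial.coeff μ (perPoly (Fin n) ℂ)) F ≠ 0 ∧
      MvPolynomial.aeval (fun μ : (Fin n × Fin n) →₀ ℕ => MvPolynomial.coeff μ (Matrix.of fun i j : Fin m => MvPolynomial.C (MvPolynomial.X (none, (i, j))) + ∑ e : Fin n × Fin n, MvPolynomial.X e * MvPolynomial.C (MvPolynomial.X (some e, (i, j))) : Matrix (Fin m) (Fin m) (MvPolynomial (Fin n × Fin n) (MvPolynomial (Option (Fin n × Fin n) × (Fin m × Fin m)) ℂ))).det) F = 0 :=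
  certWindowQP_homogSelect (NeZero.ne m) _ hhom _ q hq0 hqP

end Summit.ValiantsHypothesis.ValiantsHypothesis.Theorems
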